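import Summits.CriticalPhenomena.PercolationContinuityZ3.Theorems.FK.TranslationAverages
import Summits.CriticalPhenomena.PercolationContinuityZ3.Theorems.FK.TwoPointFunctionTailFK
import Summits.CriticalPhenomena.PercolationContinuityZ3.Theorems.FK.InfiniteVolumeDLR
import Summits.CriticalPhenomena.PercolationContinuityZ3.Theorems.FK.InfiniteVolumeInvariance
import Summits.CriticalPhenomena.PercolationContinuityZ3.Theorems.FK.ClusterDensityContinuity
import HarnessLib

/-!
# FK-continuity cell, FO-10a: laws of large numbers under `φ⁰_{p,q}`, `φ¹_{p,q}` — the density of sites where a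
# local event occurs concentrates at its probability, and `|Λ|⁻¹ Σ_{x∈Λ} |C_x|⁻¹ → κ^b(p,q)` in `L¹` and in probability
# (towards the `L¹` clause of Grimmett 2006 (4.83), with mixing (Cor. (4.23)) in place of the ergodic theorem)

Registered R111 (cell INBOX l.7597, 2026-08-25); registry row FO-10a-g342; label LLN-B (coordinator fk-4 g228).
Cell `fk-continuity` (bschramm), row FO-10a (pressure layer); support file for the FK-continuity transplant
(`--supports stmt-CriticalPhenomena-4575`); builds on p205010 (kernel theorem, internal audit signed; external expert
review pending). Pure proofs; no definitions, no named facts, no sorries; every `d`, `0 ≤ p ≤ 1`, `q ≥ 1`, both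
boundary conditions `b`. UNCONDITIONAL infinite-volume structure; it decides nothing about FH / TP_FK / the value of
`p_c(q)`.

The translations act on bond configurations of `ℤ^d` by `ω ↦ ω − v` (`BondConfig.relabel (sym2Equiv (Site.shift (-v)))`,
so that `ω − x ∈ A` says "the translate of the event `A` to the site `x` occurs"); `φ^b_{p,q} = rcLimit d b p q` is
invariant (Grimmett Thm. (4.19)(b), `InfiniteVolumeInvariance.lean`) and mixing on local events along `|v| → ∞`
(Cor. (4.23), `TwoPointFunctionTailFK.lean`), so the generic `TranslationAverages.lean` applies:

* `tendsto_rcLimit_real_inter_preimage_shift_neg` — `φ^b(A ∩ (B + v)) → φ^b(A) φ^b(B)` as `|v| → ∞` for local `A`, `B`;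
  `tendsto_rcLimit_real_inter_preimage_shift_neg_of_ae_eq` — self-mixing of every event a.e. equal to a local one;
* **`tendsto_integral_abs_density_sub_rcLimit`** — for a local event `A` and ANY finite `Λ_i ⊆ ℤ^d` with
  `|Λ_i| → ∞`: `∫ | |Λ_i|⁻¹ #{x ∈ Λ_i : ω − x ∈ A} − φ^b(A) | dφ^b → 0`, and
  **`tendsto_rcLimit_real_le_abs_density_sub`** — `φ^b(| |Λ_i|⁻¹ #{x ∈ Λ_i : ω − x ∈ A} − φ^b(A) | ≥ δ) → 0`;
* **`tendsto_integral_abs_avg_inv_ncard_sub_kappa`** — `∫ | |Λ_i|⁻¹ Σ_{x∈Λ_i} |C_x|⁻¹ − κ^b(p,q) | dφ^b_{p,q} → 0` with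
  `κ^b(p,q) = ∫ |C_0|⁻¹ dφ^b_{p,q}` (the uniform `1/N`-approximation of `|C_0|⁻¹` by the events `{|C_0| ≥ k}`,
  `ClusterSizeLocality.lean`, which are a.e. local, `ClusterDensityContinuity.lean`), its in-probability form
  **`tendsto_rcLimit_real_le_abs_avg_inv_ncard_sub_kappa`**, and the box versions along `Λ_n = [-n,n]^d`, `d ≥ 1`
  (`tendsto_integral_abs_avg_inv_ncard_box_sub_kappa`). With the boundary correction of
  `ClusterCountBoundaryCorrection.lean` this gives the `L¹` clause of (4.83) for the number of open clusters of
  `ω ∩ E_{Λ_n}` per site, and convergence in probability (companion `ClusterCountLLN.lean`); the a.s. clause of (4.83)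
  would need the pointwise multiparameter ergodic theorem, which the tree does not hold;
* `sum_indicator_preimage_eq_card_filter` — the sums above are the counts `#{x ∈ Λ : ω − x ∈ A}`.

## References

* G. Grimmett, *The Random-Cluster Model*, Springer 2006 (`book:grimmett2006-random-cluster-model`): §4.3
  Thm. (4.19)(b),(d), Cor. (4.23) [PDF pp. 77–79]; §4.5 proof of Lemma (4.79), (4.83) [PDF p. 94]. [Grimmett2006]
-/

noncomputable section

open MeasureTheory Set Filter Finset
open scoped Topology ENNReal

namespace Summit.CriticalPhenomena.PercolationContinuityZ3.Theorems.FK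

open Literature.Probability.Percolation Literature.Probability.LatticeModels

variable {d : ℕ} {p q : ℝ}

/-! ### The action `ω ↦ ω − v` of `ℤ^d` on bond configurations -/

/-- Composition of translations of configurations, as maps: `(· − (v + w)) = (· − w) ∘ (· − v)`.
[cite: Grimmett2006, §4.3 (translations τ_x)] -/
theorem coe_relabel_shift_neg_add (v w : Site d) :
    (⇑(BondConfig.relabel (sym2Equiv (Site.shift (-(v + w))))) : BondConfig (Site d) → BondConfig (Site d)) =
      ⇑(BondConfig.relabel (sym2Equiv (Site.shift (-w)))) ∘ ⇑(BondConfig.relabel (sym2Equiv (Site.shift (-v)))) := by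
  funext ω
  refine Set.ext fun z => ?_
  rw [Function.comp_apply, BondConfig.mem_relabel_iff, BondConfig.mem_relabel_iff, BondConfig.mem_relabel_iff,
    sym2Equiv_symm, sym2Equiv_symm, sym2Equiv_symm, sym2Equiv_apply, sym2Equiv_apply, sym2Equiv_apply, Sym2.map_map]
  have h : ((Site.shift (-v)).symm ∘ (Site.shift (-w)).symm : Site d → Site d) = (Site.shift (-(v + w))).symm := by
    funext x
    rw [Function.comp_apply, Site.shift_symm_apply, Site.shift_symm_apply, Site.shift_symm_apply]
    abel
  rw [h]

/-- Pointwise composition: `(ω − v) − w = ω − (v + w)`. [cite: Grimmett2006, §4.3 (translations τ_x)] -/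
theorem relabel_shift_neg_relabel_shift_neg_apply (v w : Site d) (ω : BondConfig (Site d)) :
    BondConfig.relabel (sym2Equiv (Site.shift (-w))) (BondConfig.relabel (sym2Equiv (Site.shift (-v))) ω) =
      BondConfig.relabel (sym2Equiv (Site.shift (-(v + w)))) ω :=
  (congrFun (coe_relabel_shift_neg_add v w) ω).symm

/-- **`|C_0(ω − x)| = |C_x(ω)|`**: translating the configuration by `−x` carries the cluster of `x` to the cluster of
the origin. [cite: Grimmett2006, §4.3 (translations τ_x)] -/
theorem ncard_openCluster_relabel_shift_neg (x : Site d) (ω : BondConfig (Site d)) :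
    (openCluster (BondConfig.relabel (sym2Equiv (Site.shift (-x))) ω) (0 : Site d)).ncard = (openCluster ω x).ncard := by
  have h := openCluster_relabel_shift (-x) ω x
  rw [add_neg_cancel] at h
  rw [h, Set.ncard_image_of_injective _ (add_left_injective (-x))]

/-- The indicator sums of this file are counts: `Σ_{x∈Λ} 1_{T_x⁻¹A}(ω) = #{x ∈ Λ : T_x ω ∈ A}`. [folklore] -/
theorem sum_indicator_preimage_eq_card_filter {Ω G : Type*} (T : G → Ω → Ω) (A : Set Ω) (Λ : Finset G) (ω : Ω)
    [DecidablePred fun x => T x ω ∈ A] :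
    ∑ x ∈ Λ, (T x ⁻¹' A).indicator (1 : Ω → ℝ) ω = #(Λ.filter fun x => T x ω ∈ A) := by
  rw [← Finset.sum_boole]
  refine Finset.sum_congr rfl fun x _ => ?_
  by_cases h : T x ω ∈ A
  · rw [Set.indicator_of_mem (show ω ∈ T x ⁻¹' A from h), Pi.one_apply, if_pos h]
  · rw [Set.indicator_of_notMem (show ω ∉ T x ⁻¹' A from h), if_neg h]

/-! ### Mixing of `φ^b_{p,q}` along `|v| → ∞` in the form consumed by `TranslationAverages.lean` -/

/-- **Grimmett 2006, Cor. (4.23) for `φ^b_{p,q}`, pulled back along `v ↦ −v`**: for local events `A`, `B`,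
`φ^b(A ∩ {ω : ω − v ∈ B}) → φ^b(A) φ^b(B)` as `|v| → ∞`. [cite: Grimmett2006, Cor. (4.23)] -/
theorem tendsto_rcLimit_real_inter_preimage_shift_neg (b : Bool) (hp : p ∈ Set.Icc (0 : ℝ) 1) (hq : 1 ≤ q)
    {A B : Set (BondConfig (Site d))} (hA : IsLocalEvent A) (hB : IsLocalEvent B) :
    Tendsto (fun v : Site d => (rcLimit d b p q).real (A ∩ BondConfig.relabel (sym2Equiv (Site.shift (-v))) ⁻¹' B))
      cofinite (𝓝 ((rcLimit d b p q).real A * (rcLimit d b p q).real B)) := by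
  have hP := isBoxLimit_rcLimit b hp hq (d := d)
  have h := hP.tendsto_real_inter_preimage_shift_cofinite (hP.fkGibbs hp hq) (hP.measurePreserving_relabel_shift hp hq)
    hp (one_pos.trans_le hq) hA hB
  exact h.comp neg_injective.tendsto_cofinite

/-- **Self-mixing of events a.e. equal to local events**: if `A =ᵐ L` with `L` local then
`φ^b(A ∩ {ω : ω − v ∈ A}) → φ^b(A)²`. [cite: Grimmett2006, Cor. (4.23)] -/
theorem tendsto_rcLimit_real_inter_preimage_shift_neg_of_ae_eq (b : Bool) (hp : p ∈ Set.Icc (0 : ℝ) 1) (hq : 1 ≤ q)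
    {A L : Set (BondConfig (Site d))} (hL : IsLocalEvent L) (hAL : A =ᵐ[rcLimit d b p q] L) :
    Tendsto (fun v : Site d => (rcLimit d b p q).real (A ∩ BondConfig.relabel (sym2Equiv (Site.shift (-v))) ⁻¹' A))
      cofinite (𝓝 ((rcLimit d b p q).real A ^ 2)) := by
  have hT := (isBoxLimit_rcLimit b hp hq (d := d)).measurePreserving_relabel_shift hp hq
  rw [sq, measureReal_congr hAL]
  refine (tendsto_rcLimit_real_inter_preimage_shift_neg b hp hq hL hL).congr' (Eventually.of_forall fun v => ?_)
  exact (measureReal_congr (hAL.inter ((hT (-v)).quasiMeasurePreserving.preimage_ae_eq hAL))).symm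

/-! ### The density of sites where a local event occurs -/

/-- **Law of large numbers for local events under `φ^b_{p,q}` (`L¹`)**: for a local event `A` and finite sets
`Λ_i ⊆ ℤ^d` with `|Λ_i| → ∞`, `∫ | |Λ_i|⁻¹ Σ_{x∈Λ_i} 1_A(ω − x) − φ^b_{p,q}(A) | dφ^b_{p,q} → 0`.
[cite: Grimmett2006, Cor. (4.23) with §4.5 (4.83)] -/
theorem tendsto_integral_abs_density_sub_rcLimit (b : Bool) (hp : p ∈ Set.Icc (0 : ℝ) 1) (hq : 1 ≤ q)
    {A : Set (BondConfig (Site d))} (hA : IsLocalEvent A)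
    {ι : Type*} {l : Filter ι} {Λ : ι → Finset (Site d)} (hΛ : Tendsto (fun i => (#(Λ i) : ℝ)) l atTop) :
    Tendsto (fun i => ∫ ω, |(#(Λ i) : ℝ)⁻¹ *
        ∑ x ∈ Λ i, (BondConfig.relabel (sym2Equiv (Site.shift (-x))) ⁻¹' A).indicator (1 : BondConfig (Site d) → ℝ) ω -
        (rcLimit d b p q).real A| ∂(rcLimit d b p q)) l (𝓝 0) := by
  haveI := isProbabilityMeasure_rcLimit (d := d) b p q
  have h := tendsto_rcLimit_real_inter_preimage_shift_neg b hp hq hA hA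
  rw [← sq] at h
  exact tendsto_integral_abs_avg_indicator_sub (T := fun v => ⇑(BondConfig.relabel (sym2Equiv (Site.shift (-v)))))
    (fun v => (BondConfig.relabel _).measurable) relabel_shift_neg_relabel_shift_neg_apply
    ((isBoxLimit_rcLimit b hp hq).measurePreserving_relabel_shift hp hq <| -·) (measurableSet_of_isLocalEvent_holds hA)
    h hΛ

/-- **Law of large numbers for local events under `φ^b_{p,q}` (in probability)**: for every `δ > 0`,
`φ^b_{p,q}(| |Λ_i|⁻¹ Σ_{x∈Λ_i} 1_A(ω − x) − φ^b_{p,q}(A) | ≥ δ) → 0`. [cite: Grimmett2006, Cor. (4.23) with §4.5 (4.83)] -/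
theorem tendsto_rcLimit_real_le_abs_density_sub (b : Bool) (hp : p ∈ Set.Icc (0 : ℝ) 1) (hq : 1 ≤ q)
    {A : Set (BondConfig (Site d))} (hA : IsLocalEvent A)
    {ι : Type*} {l : Filter ι} {Λ : ι → Finset (Site d)} (hΛ : Tendsto (fun i => (#(Λ i) : ℝ)) l atTop)
    {δ : ℝ} (hδ : 0 < δ) :
    Tendsto (fun i => (rcLimit d b p q).real {ω | δ ≤ |(#(Λ i) : ℝ)⁻¹ *
        ∑ x ∈ Λ i, (BondConfig.relabel (sym2Equiv (Site.shift (-x))) ⁻¹' A).indicator (1 : BondConfig (Site d) → ℝ) ω -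
        (rcLimit d b p q).real A|}) l (𝓝 0) := by
  haveI := isProbabilityMeasure_rcLimit (d := d) b p q
  have hAm := measurableSet_of_isLocalEvent_holds hA
  refine tendsto_measureReal_le_abs_of_integral (fun i => ?_) (tendsto_integral_abs_density_sub_rcLimit b hp hq hA hΛ) hδ
  exact ((integrable_finsetSum _ fun x _ => (memLp_two_indicator_preimage
    (T := fun v => ⇑(BondConfig.relabel (sym2Equiv (Site.shift (-v))))) (fun v => (BondConfig.relabel _).measurable)
    hAm x).integrable one_le_two).const_mul _).sub (integrable_const _)

/-! ### Grimmett's (4.83): `|Λ|⁻¹ Σ_{x∈Λ} |C_x|⁻¹ → κ^b(p,q)` in `L¹(φ^b_{p,q})` and in probability -/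

/-- `{|C_0| ≥ k}` is `φ^b_{p,q}`-a.e. equal to a LOCAL event (its proxy computed inside `Λ_k`).
[cite: Grimmett2006, §4.5 proof of Lemma (4.79)] -/
theorem clusterSizeGe_ae_eq_local (b : Bool) (hp : p ∈ Set.Icc (0 : ℝ) 1) (hq : 1 ≤ q) (k : ℕ) :
    clusterSizeGe (0 : Site d) k =ᵐ[rcLimit d b p q]
      {ω | (k : ℕ∞) ≤ (openCluster (ω ∩ ↑(edgesIn (zdGraph d) (box d (0 + k)))) (0 : Site d)).encard} := by
  have hlat := (isBoxLimit_rcLimit b hp hq (d := d)).ae_subset_edgeSet hp (one_pos.trans_le hq)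
  filter_upwards [hlat] with ω hω
  change (ω ∈ clusterSizeGe (0 : Site d) k) = (ω ∈ {ω | (k : ℕ∞) ≤
    (openCluster (ω ∩ ↑(edgesIn (zdGraph d) (box d (0 + k)))) (0 : Site d)).encard})
  rw [mem_clusterSizeGe, Set.mem_setOf_eq, le_encard_openCluster_inter_edgesIn_iff hω (zero_mem_box d 0)]

/-- The origin's cluster has at least one vertex: `ω ∈ {|C_0| ≥ k}` for `k ≤ 1`; in particular the indicator of
`{|C_0| ≥ 0}` is `1`. [folklore] -/
theorem indicator_clusterSizeGe_zero (ω : BondConfig (Site d)) :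
    (clusterSizeGe (0 : Site d) 0).indicator (1 : BondConfig (Site d) → ℝ) ω = 1 := by
  rw [clusterSizeGe_zero, Set.indicator_univ, Pi.one_apply]

open Classical in
/-- **The `1/N`-approximant of `|C_0|⁻¹` as a combination of indicators**: with `c_0 = 1`, `c_k = −1/((k−1)k)`,
`Σ_{k ∈ {0} ∪ [2,N]} c_k 1{|C_0| ≥ k} = 1 − Σ_{k=2}^{N} 1{|C_0| ≥ k}/((k−1)k)`, hence within `1/N` of `|C_0|⁻¹`.
[cite: Grimmett2006, §4.5 proof of Lemma (4.79)] -/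
theorem abs_inv_ncard_sub_sum_indicator_le (ω : BondConfig (Site d)) {N : ℕ} (hN : 1 ≤ N) :
    |((openCluster ω (0 : Site d)).ncard : ℝ)⁻¹ -
        ∑ k ∈ insert 0 (Finset.Icc 2 N), (if k = 0 then (1 : ℝ) else -(1 / (((k : ℝ) - 1) * k))) *
          (clusterSizeGe (0 : Site d) k).indicator (1 : BondConfig (Site d) → ℝ) ω| ≤ 1 / N := by
  have h := abs_inv_ncard_sub_le (0 : Site d) ω N hN
  rw [Finset.sum_insert (by simp), if_pos rfl, indicator_clusterSizeGe_zero, mul_one]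
  have hsum : ∑ k ∈ Finset.Icc 2 N, (if k = 0 then (1 : ℝ) else -(1 / (((k : ℝ) - 1) * k))) *
      (clusterSizeGe (0 : Site d) k).indicator (1 : BondConfig (Site d) → ℝ) ω =
      -∑ k ∈ Finset.Icc 2 N, (if ω ∈ clusterSizeGe (0 : Site d) k then (1 : ℝ) / (((k : ℝ) - 1) * k) else 0) := by
    rw [← Finset.sum_neg_distrib]
    refine Finset.sum_congr rfl fun k hk => ?_
    have hk0 : k ≠ 0 := by have := (Finset.mem_Icc.1 hk).1; omega
    rw [if_neg hk0, Set.indicator_apply, Pi.one_apply]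
    split_ifs <;> ring
  rw [hsum, ← sub_eq_add_neg]
  exact h

/-- **Towards Grimmett 2006 (4.83) (`L¹` clause), infinite-volume form: `∫ | |Λ_i|⁻¹ Σ_{x∈Λ_i} |C_x(ω)|⁻¹ − κ^b(p,q) | dφ^b_{p,q} → 0`**
for all finite `Λ_i ⊆ ℤ^d` with `|Λ_i| → ∞`, where `κ^b(p,q) = ∫ |C_0|⁻¹ dφ^b_{p,q}` (`b ∈ {0,1}`, `0 ≤ p ≤ 1`, `q ≥ 1`).
Mixing (Cor. (4.23)) replaces the ergodic theorem. [cite: Grimmett2006, §4.5 (4.83)] -/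
theorem tendsto_integral_abs_avg_inv_ncard_sub_kappa (b : Bool) (hp : p ∈ Set.Icc (0 : ℝ) 1) (hq : 1 ≤ q)
    {ι : Type*} {l : Filter ι} {Λ : ι → Finset (Site d)} (hΛ : Tendsto (fun i => (#(Λ i) : ℝ)) l atTop) :
    Tendsto (fun i => ∫ ω, |(#(Λ i) : ℝ)⁻¹ * ∑ x ∈ Λ i, ((openCluster ω x).ncard : ℝ)⁻¹ -
        ∫ ω', ((openCluster ω' (0 : Site d)).ncard : ℝ)⁻¹ ∂(rcLimit d b p q)| ∂(rcLimit d b p q)) l (𝓝 0) := by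
  haveI := isProbabilityMeasure_rcLimit (d := d) b p q
  have h := tendsto_integral_abs_avg_sub_integral (T := fun v => ⇑(BondConfig.relabel (sym2Equiv (Site.shift (-v)))))
    (P := rcLimit d b p q) (fun v => (BondConfig.relabel _).measurable) relabel_shift_neg_relabel_shift_neg_apply
    ((isBoxLimit_rcLimit b hp hq).measurePreserving_relabel_shift hp hq <| -·)
    (f := fun ω => ((openCluster ω (0 : Site d)).ncard : ℝ)⁻¹) (measurable_inv_ncard_openCluster' 0) (M := 1)
    (fun ω => by
      rw [abs_of_nonneg (inv_nonneg.2 (Nat.cast_nonneg _))]; exact Nat.cast_inv_le_one _)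
    (fun ε hε => ?_) hΛ
  · simpa only [ncard_openCluster_relabel_shift_neg] using h
  -- the approximants: `N` with `1/N ≤ ε`, `t = {0} ∪ [2, N]`, `B_k = {|C_0| ≥ k}`
  obtain ⟨N, hN⟩ := exists_nat_one_div_lt hε
  refine ⟨insert 0 (Finset.Icc 2 (N + 1)), fun k => if k = 0 then (1 : ℝ) else -(1 / (((k : ℝ) - 1) * k)),
    fun k => clusterSizeGe (0 : Site d) k, fun k _ => ⟨measurableSet_clusterSizeGe _ _, ?_⟩, ?_⟩
  · exact tendsto_rcLimit_real_inter_preimage_shift_neg_of_ae_eq b hp hq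
      ⟨_, determinedBy_le_encard_openCluster_inter (0 : Site d) 0 k⟩ (clusterSizeGe_ae_eq_local b hp hq k)
  · have hN1 : (1 : ℝ) / ((N + 1 : ℕ) : ℝ) ≤ ε := by push_cast; exact hN.le
    calc ∫ ω, |((openCluster ω (0 : Site d)).ncard : ℝ)⁻¹ -
          ∑ k ∈ insert 0 (Finset.Icc 2 (N + 1)), (if k = 0 then (1 : ℝ) else -(1 / (((k : ℝ) - 1) * k))) *
            (clusterSizeGe (0 : Site d) k).indicator (1 : BondConfig (Site d) → ℝ) ω| ∂(rcLimit d b p q)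
        ≤ ∫ _, (1 : ℝ) / ((N + 1 : ℕ) : ℝ) ∂(rcLimit d b p q) :=
          integral_mono_of_nonneg (Eventually.of_forall fun ω => abs_nonneg _) (integrable_const _)
            (Eventually.of_forall fun ω => abs_inv_ncard_sub_sum_indicator_le ω (by omega))
      _ = (1 : ℝ) / ((N + 1 : ℕ) : ℝ) := by rw [integral_const, smul_eq_mul, probReal_univ, one_mul]
      _ ≤ ε := hN1

/-- **Infinite-volume form of (4.83), in probability**: for every `δ > 0`,
`φ^b_{p,q}(| |Λ_i|⁻¹ Σ_{x∈Λ_i} |C_x|⁻¹ − κ^b(p,q) | ≥ δ) → 0`. [cite: Grimmett2006, §4.5 (4.83)] -/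
theorem tendsto_rcLimit_real_le_abs_avg_inv_ncard_sub_kappa (b : Bool) (hp : p ∈ Set.Icc (0 : ℝ) 1) (hq : 1 ≤ q)
    {ι : Type*} {l : Filter ι} {Λ : ι → Finset (Site d)} (hΛ : Tendsto (fun i => (#(Λ i) : ℝ)) l atTop)
    {δ : ℝ} (hδ : 0 < δ) :
    Tendsto (fun i => (rcLimit d b p q).real {ω | δ ≤ |(#(Λ i) : ℝ)⁻¹ * ∑ x ∈ Λ i, ((openCluster ω x).ncard : ℝ)⁻¹ -
        ∫ ω', ((openCluster ω' (0 : Site d)).ncard : ℝ)⁻¹ ∂(rcLimit d b p q)|}) l (𝓝 0) := by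
  haveI := isProbabilityMeasure_rcLimit (d := d) b p q
  refine tendsto_measureReal_le_abs_of_integral (fun i => ?_)
    (tendsto_integral_abs_avg_inv_ncard_sub_kappa b hp hq hΛ) hδ
  exact ((integrable_finsetSum _ fun x _ => integrable_inv_ncard_openCluster' x _).const_mul _).sub
    (integrable_const _)

/-! ### Along the boxes `Λ_n = [-n,n]^d` -/

/-- `|Λ_n| → ∞` for `d ≥ 1` (as real numbers). [folklore] -/
theorem tendsto_natCast_card_box_atTop (hd : 0 < d) : Tendsto (fun n : ℕ => (#(box d n) : ℝ)) atTop atTop := by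
  have h : Tendsto (fun n : ℕ => #(box d n)) atTop atTop := by
    refine tendsto_atTop_mono (fun n => ?_) tendsto_id
    rw [card_box]
    calc n ≤ 2 * n + 1 := by omega
      _ = (2 * n + 1) ^ 1 := (pow_one _).symm
      _ ≤ (2 * n + 1) ^ d := Nat.pow_le_pow_right (by omega) hd
  exact tendsto_natCast_atTop_atTop.comp h

/-- **(4.83) along boxes, in `L¹`**: `∫ | |Λ_n|⁻¹ Σ_{x∈Λ_n} |C_x|⁻¹ − κ^b(p,q) | dφ^b_{p,q} → 0` as `n → ∞` (`d ≥ 1`).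
[cite: Grimmett2006, §4.5 (4.83)] -/
theorem tendsto_integral_abs_avg_inv_ncard_box_sub_kappa (hd : 0 < d) (b : Bool) (hp : p ∈ Set.Icc (0 : ℝ) 1)
    (hq : 1 ≤ q) :
    Tendsto (fun n : ℕ => ∫ ω, |(#(box d n) : ℝ)⁻¹ * ∑ x ∈ box d n, ((openCluster ω x).ncard : ℝ)⁻¹ -
        ∫ ω', ((openCluster ω' (0 : Site d)).ncard : ℝ)⁻¹ ∂(rcLimit d b p q)| ∂(rcLimit d b p q)) atTop (𝓝 0) :=
  tendsto_integral_abs_avg_inv_ncard_sub_kappa b hp hq (tendsto_natCast_card_box_atTop hd)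

/-- **(4.83) along boxes, in probability**: `φ^b_{p,q}(| |Λ_n|⁻¹ Σ_{x∈Λ_n} |C_x|⁻¹ − κ^b(p,q) | ≥ δ) → 0` (`d ≥ 1`,
`δ > 0`). [cite: Grimmett2006, §4.5 (4.83)] -/
theorem tendsto_rcLimit_real_le_abs_avg_inv_ncard_box_sub_kappa (hd : 0 < d) (b : Bool)
    (hp : p ∈ Set.Icc (0 : ℝ) 1) (hq : 1 ≤ q) {δ : ℝ} (hδ : 0 < δ) :
    Tendsto (fun n : ℕ => (rcLimit d b p q).real {ω | δ ≤ |(#(box d n) : ℝ)⁻¹ *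
        ∑ x ∈ box d n, ((openCluster ω x).ncard : ℝ)⁻¹ -
        ∫ ω', ((openCluster ω' (0 : Site d)).ncard : ℝ)⁻¹ ∂(rcLimit d b p q)|}) atTop (𝓝 0) :=
  tendsto_rcLimit_real_le_abs_avg_inv_ncard_sub_kappa b hp hq (tendsto_natCast_card_box_atTop hd) hδ

/-- **Local-event densities along boxes, in probability**: for a local event `A`, `d ≥ 1` and `δ > 0`,
`φ^b_{p,q}(| |Λ_n|⁻¹ #{x ∈ Λ_n : ω − x ∈ A} − φ^b_{p,q}(A) | ≥ δ) → 0`. [cite: Grimmett2006, Cor. (4.23) with §4.5 (4.83)] -/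
theorem tendsto_rcLimit_real_le_abs_density_box_sub (hd : 0 < d) (b : Bool) (hp : p ∈ Set.Icc (0 : ℝ) 1)
    (hq : 1 ≤ q) {A : Set (BondConfig (Site d))} (hA : IsLocalEvent A) {δ : ℝ} (hδ : 0 < δ) :
    Tendsto (fun n : ℕ => (rcLimit d b p q).real {ω | δ ≤ |(#(box d n) : ℝ)⁻¹ *
        ∑ x ∈ box d n, (BondConfig.relabel (sym2Equiv (Site.shift (-x))) ⁻¹' A).indicator
          (1 : BondConfig (Site d) → ℝ) ω - (rcLimit d b p q).real A|}) atTop (𝓝 0) :=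
  tendsto_rcLimit_real_le_abs_density_sub b hp hq hA (tendsto_natCast_card_box_atTop hd) hδ

end Summit.CriticalPhenomena.PercolationContinuityZ3.Theorems.FK

end
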